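import Summits.CriticalPhenomena.PercolationContinuityZ3.Theorems.PercNearOneGluingNoHeavyQuantGluedChildrenThree
import Summits.CriticalPhenomena.PercolationContinuityZ3.Theorems.PercNearOneGluingNoHeavyQuantHighConv
import HarnessLib

/-!
# QUANT lane R8, T-DEC: THE THREE-PIECE MIXTURE OF A GATED 3-CHAIN `R[q](R[p](R[s]))` — heavy blob + far-giant piece + LIGHT piece —, the
# light piece is HIGH, `C(γ) ∗ H(θ)` is HIGH, and one gated 3-chain is SDEC at every floor `x ≤ qps` (tools for `…QuantThreeChainsThree`)

builds on p205010 (kernel theorem, internal audit signed; external expert review pending)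

Support file (`--supports stmt-CriticalPhenomena-4575`), QUANT lane seat prim-quant-census-1 (gen 30); memo
`run/shared/lean/prim/quant/prim-quant-census-1/g30/SUBFLOOR-HUBS-G30.md` §3 (4).  Theorems only (standard axioms, no sorries), over
`…QuantGluedChildrenThree` (✓ p557095: `cp_laws`, `lconv_laws`, …), `…QuantHighConv` (✓ p548056, arm-1 g57: `IsHigh`, `sdec_lconv_high`),
`…QuantHullHigh` (`isHigh_sdec`).

THE DECOMPOSITION.  The gated 3-chain `t = gate{1: 1−p, 2: p(1−s), 3: ps} q` with `m = q(1+p+ps) ≥ 2` is EXACTLY the same-mean mixture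
`α·blob₃(m/3) + (1−α)·N`, `N = β′·C((m−1)/2) + δ′·H(m−2)`, with `α = 3(1−q)/(3−m)`, `β′ = 2(1−p)/(2−p−ps)`, `δ′ = p(1−s)/(2−p−ps)`
(`gate_chain3_eq_mix`; `C(γ) = {1,3;γ}` the far-giant piece, `H(θ) = {2,3;θ}` the LIGHT piece — two sure relays over a 1-blob; the glued child
`s = 1` has `δ′ = 0`).  `H(θ)` is HIGH at every floor with `3x ≤ m` (`isHigh_hp`), so it peels off any SDEC core by HIGH-CONV; `C(γ) ∗ H(θ)` is
HIGH outright (`isHigh_farPieceHp`: least atom `3 ≥ (m₁ + m₂)/2`).  Hence the piece expansion of a forest of 3-chains needs exactly the three cores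
of the glued case (`sdec_farPieceBlob`, `sdec_pairHub`, `sdec_tripleHub`) plus HIGH-CONV — carried out for width 3 in `…QuantThreeChainsThree`.
* `hp_laws`, **`isHigh_hp`**, `farPieceHp_eq_lconv`, **`isHigh_farPieceHp`**, `chain3_laws`, `chain3_params` (`α, β′ ∈ [0,1]`, `1−β′ = δ′`,
  ranges of `m/3`, `(m−1)/2`, `m−2`), **`gate_chain3_eq_mix`**, `mix_laws`, `np_laws` (the sub-floor part `N` is a probability law of mean `m`),
  `chain3_eq_lconv` (`{1:1−p,2:p(1−s),3:ps} = δ₁ ∗ gate(δ₁ ∗ gate δ₁ s) p`), **`sdec_chain3`** (one gated 3-chain is SDEC at every `0 < x ≤ qps`, `s < 1`).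
HONEST STATUS.  Tools; `SiblingStep` ⟺ `GateStepN`, `FarTreeRow` OPEN; RATE class (log\*) / honest sentence of `run/shared/lean/prim/quant/README.md`
unchanged.  [this work].  Nothing here is cited as a published result.  The gluing rows served [cite: KozmaNitzan2024, Conjecture 3 (p. 15)];
product measure [cite: Grimmett1999, §1.3 p. 10].
-/

noncomputable section

open scoped BigOperators

namespace Summit.CriticalPhenomena.PercolationContinuityZ3.Theorems
namespace Quant
namespace LawDec

open Finset

/-- the point mass `δ_K` -/
local notation3 "δ[" K "]" => (fun k : ℕ => if k = (K : ℕ) then (1 : ℝ) else 0)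

/-- the law `{1, 3; a}` (glued pair under a sure relay / far-giant piece) -/
local notation3 "CP[" a "]" => (fun h : ℕ => (1 - (a : ℝ)) * (if h = 1 then (1 : ℝ) else 0) + (a : ℝ) * (if h = 3 then (1 : ℝ) else 0))

/-- the LIGHT PIECE `{2, 3; θ}` of a gated 3-chain: two sure relays over a 1-blob -/
local notation3 "HP[" a "]" => (fun h : ℕ => (1 - (a : ℝ)) * (if h = 2 then (1 : ℝ) else 0) + (a : ℝ) * (if h = 3 then (1 : ℝ) else 0))

/-- the 3-chain's sub-forest law `{1: 1−p, 2: p(1−s), 3: ps}` (`R[p](R[s])` under a sure relay) -/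
local notation3 "CH[" p ", " s "]" => (fun h : ℕ => (1 - (p : ℝ)) * (if h = 1 then (1 : ℝ) else 0) +
  (p : ℝ) * (1 - (s : ℝ)) * (if h = 2 then (1 : ℝ) else 0) + (p : ℝ) * (s : ℝ) * (if h = 3 then (1 : ℝ) else 0))

/-- the SUB-FLOOR PART of a gated 3-chain (`m = q(1+p+ps)`): the same-mean mixture `β′·C((m−1)/2) + δ′·H(m−2)`,
`β′ = 2(1−p)/(2−p−ps)`, `δ′ = p(1−s)/(2−p−ps)` -/
local notation3 "NP[" q ", " p ", " s "]" => (fun h : ℕ =>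
  2 * (1 - (p : ℝ)) / (2 - p - p * s) * CP[((q : ℝ) * (1 + p + p * s) - 1) / 2] h +
  (p : ℝ) * (1 - s) / (2 - p - p * s) * HP[(q : ℝ) * (1 + p + p * s) - 2] h)

/-! ### The light piece and the high cores -/

/-- law facts of the light piece `{2,3;θ}` (`0 ≤ θ ≤ 1`): mass `1`, mean `2 + θ`. [this work] -/
theorem hp_laws {a : ℝ} (h0 : 0 ≤ a) (h1 : a ≤ 1) :
    (∀ h, 0 ≤ HP[a] h) ∧ (∀ h, 3 < h → HP[a] h = 0) ∧ ∑ h ∈ Finset.range (3 + 1), HP[a] h = 1 ∧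
      ∑ h ∈ Finset.range (3 + 1), (h : ℝ) * HP[a] h = 2 + a := by
  refine ⟨fun h => ?_, fun h hh => ?_, ?_, ?_⟩
  · dsimp only; split_ifs <;> linarith
  · dsimp only; rw [if_neg (by omega), if_neg (by omega)]; ring
  · simp [Finset.sum_range_succ]
  · simp [Finset.sum_range_succ]; ring

/-- **the light piece `{2,3;θ}` is HIGH** at every floor with `3x ≤ 2 + θ` (charged atoms `2, 3 ≥ (2+θ)/2`). [this work] -/
theorem isHigh_hp {x a : ℝ} (h0 : 0 ≤ a) (h1 : a ≤ 1) (hx : 3 * x ≤ 2 + a) : IsHigh x (2 + a) 3 HP[a] := by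
  obtain ⟨l0, lM, l1, lmean⟩ := hp_laws h0 h1
  refine ⟨l0, lM, l1, lmean, fun h hpos => ?_, by push_cast; linarith⟩
  have h23 : h = 2 ∨ h = 3 := by
    by_contra hne
    have hne2 : h ≠ 2 := fun e => hne (Or.inl e)
    have hne3 : h ≠ 3 := fun e => hne (Or.inr e)
    have : HP[a] h = 0 := by dsimp only; rw [if_neg hne2, if_neg hne3]; ring
    rw [this] at hpos; exact lt_irrefl _ hpos
  rcases h23 with rfl | rfl
  · push_cast; linarith
  · push_cast; linarith

/-- the high core `C(γ) ∗ H(θ)` on `{3,4,5,6}` explicitly. [this work] -/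
theorem farPieceHp_eq_lconv (c a : ℝ) : lconv 3 3 CP[c] HP[a] = fun h : ℕ =>
    (1 - c) * (1 - a) * (if h = 3 then (1 : ℝ) else 0) + (1 - c) * a * (if h = 4 then (1 : ℝ) else 0) +
    c * (1 - a) * (if h = 5 then (1 : ℝ) else 0) + c * a * (if h = 6 then (1 : ℝ) else 0) := by
  funext h
  simp only [lconv, Finset.sum_range_succ, Finset.sum_range_zero]
  rcases Nat.lt_or_ge h 7 with hh | hh
  · interval_cases h
    all_goals norm_num
  · simp [show h ≠ 3 by omega, show h ≠ 4 by omega, show h ≠ 5 by omega, show h ≠ 6 by omega, show (3 : ℕ) ≠ h by omega,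
      show (4 : ℕ) ≠ h by omega, show (5 : ℕ) ≠ h by omega, show (6 : ℕ) ≠ h by omega]

/-- **`C(γ) ∗ H(θ)` IS HIGH** (aggregate-light: least atom `3 ≥ (3 + 2γ + θ)/2`) at every floor `x` with `6x ≤ 3 + 2γ + θ`. [this work] -/
theorem isHigh_farPieceHp {x c a : ℝ} (hc0 : 0 ≤ c) (hc1 : c ≤ 1) (h0 : 0 ≤ a) (h1 : a ≤ 1) (hx : 6 * x ≤ 3 + 2 * c + a) :
    IsHigh x ((1 + 2 * c) + (2 + a)) (3 + 3) (lconv 3 3 CP[c] HP[a]) := by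
  obtain ⟨c0, _, c1, cmean⟩ := cp_laws hc0 hc1
  obtain ⟨a0, _, a1, amean⟩ := hp_laws h0 h1
  obtain ⟨l0, lM, l1, lmean⟩ := lconv_laws c0 c1 cmean a0 a1 amean
  refine ⟨l0, lM, l1, lmean, fun h hpos => ?_, by push_cast; linarith⟩
  rw [farPieceHp_eq_lconv] at hpos
  have h36 : 3 ≤ h := by
    by_contra hlt
    have hlt : h < 3 := Nat.lt_of_not_le hlt
    have : (fun h : ℕ => (1 - c) * (1 - a) * (if h = 3 then (1 : ℝ) else 0) + (1 - c) * a * (if h = 4 then (1 : ℝ) else 0) +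
        c * (1 - a) * (if h = 5 then (1 : ℝ) else 0) + c * a * (if h = 6 then (1 : ℝ) else 0)) h = 0 := by
      dsimp only; rw [if_neg (by omega), if_neg (by omega), if_neg (by omega), if_neg (by omega)]; ring
    rw [this] at hpos; exact lt_irrefl _ hpos
  have : (3 : ℝ) ≤ h := by exact_mod_cast h36
  linarith

/-! ### The gated 3-chain and its three-piece mixture -/

/-- law facts of the 3-chain sub-forest law `{1: 1−p, 2: p(1−s), 3: ps}` and of its gated version (mean `q(1+p+ps)`). [this work] -/
theorem chain3_laws {q p s : ℝ} (hq0 : 0 ≤ q) (hq1 : q ≤ 1) (hp0 : 0 ≤ p) (hp1 : p ≤ 1) (hs0 : 0 ≤ s) (hs1 : s ≤ 1) :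
    ((∀ h, 0 ≤ CH[p, s] h) ∧ (∀ h, 3 < h → CH[p, s] h = 0) ∧ ∑ h ∈ Finset.range (3 + 1), CH[p, s] h = 1 ∧
      ∑ h ∈ Finset.range (3 + 1), (h : ℝ) * CH[p, s] h = 1 + p + p * s) ∧
    ((∀ h, 0 ≤ gate CH[p, s] q h) ∧ (∀ h, 3 < h → gate CH[p, s] q h = 0) ∧ ∑ h ∈ Finset.range (3 + 1), gate CH[p, s] q h = 1 ∧
      ∑ h ∈ Finset.range (3 + 1), (h : ℝ) * gate CH[p, s] q h = q * (1 + p + p * s)) := by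
  have c0 : ∀ h, 0 ≤ CH[p, s] h := by
    intro h; dsimp only
    have : 0 ≤ p * (1 - s) := mul_nonneg hp0 (by linarith)
    have : 0 ≤ p * s := mul_nonneg hp0 hs0
    split_ifs <;> linarith
  have cM : ∀ h, 3 < h → CH[p, s] h = 0 := by
    intro h hh; dsimp only; rw [if_neg (by omega), if_neg (by omega), if_neg (by omega)]; ring
  have c1 : ∑ h ∈ Finset.range (3 + 1), CH[p, s] h = 1 := by simp [Finset.sum_range_succ]; ring
  have cmean : ∑ h ∈ Finset.range (3 + 1), (h : ℝ) * CH[p, s] h = 1 + p + p * s := by simp [Finset.sum_range_succ]; ring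
  obtain ⟨g0, gM, g1⟩ := gate_laws 3 CH[p, s] q hq0 hq1 c0 cM c1
  exact ⟨⟨c0, cM, c1, cmean⟩, g0, gM, g1, by rw [sum_mul_gate, cmean]⟩

/-- parameter facts of a 3-chain `R[q](R[p](R[s]))` with `m = q(1+p+ps) ≥ 2`: `3 − m > 0`, `2 − p − ps > 0`, `α = 3(1−q)/(3−m) ∈ [0,1]`,
`β′, δ′ ∈ [0,1]`, `β′ + δ′ = 1`, `m/3 ∈ [2/3,1)`, `(m−1)/2 ∈ [1/2,1)`, `m − 2 ∈ [0,1)`. [this work] -/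
theorem chain3_params {q p s : ℝ} (hq0 : 0 < q) (hq1 : q < 1) (hp0 : 0 < p) (hp1 : p < 1) (hs0 : 0 < s) (hs1 : s ≤ 1)
    (hm : 2 ≤ q * (1 + p + p * s)) :
    0 < 3 - q * (1 + p + p * s) ∧ 0 < 2 - p - p * s ∧
      0 ≤ 3 * (1 - q) / (3 - q * (1 + p + p * s)) ∧ 3 * (1 - q) / (3 - q * (1 + p + p * s)) ≤ 1 ∧
      0 ≤ 2 * (1 - p) / (2 - p - p * s) ∧ 2 * (1 - p) / (2 - p - p * s) ≤ 1 ∧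
      (1 - 2 * (1 - p) / (2 - p - p * s) = p * (1 - s) / (2 - p - p * s)) ∧
      2 / 3 ≤ q * (1 + p + p * s) / 3 ∧ q * (1 + p + p * s) / 3 < 1 ∧
      1 / 2 ≤ (q * (1 + p + p * s) - 1) / 2 ∧ (q * (1 + p + p * s) - 1) / 2 < 1 ∧
      0 ≤ q * (1 + p + p * s) - 2 ∧ q * (1 + p + p * s) - 2 ≤ 1 := by
  have hps : p * s ≤ p := by nlinarith
  have hps0 : 0 ≤ p * s := by positivity
  have h1 : q * (1 + p + p * s) < 1 + p + p * s := by nlinarith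
  have h3 : 0 < 3 - q * (1 + p + p * s) := by linarith
  have h2 : 0 < 2 - p - p * s := by nlinarith
  have hq3 : q * (1 + p + p * s) ≤ 3 * q := by nlinarith
  refine ⟨h3, h2, div_nonneg (by linarith) h3.le, by rw [div_le_one h3]; linarith, div_nonneg (by linarith) h2.le,
    by rw [div_le_one h2]; nlinarith, ?_, by linarith, by linarith, by linarith, by linarith, by linarith, by linarith⟩
  field_simp
  ring

/-- **THE THREE-PIECE MIXTURE OF A GATED 3-CHAIN** (`m = q(1+p+ps)`): `gate{1:1−p, 2:p(1−s), 3:ps} q = α·blob₃(m/3) + (1−α)·N` pointwise, with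
`α = 3(1−q)/(3−m)` and the sub-floor part `N = β′·C((m−1)/2) + δ′·H(m−2)` (`q,p < 1`). [this work] -/
theorem gate_chain3_eq_mix {q p s : ℝ} (hq0 : 0 < q) (hq1 : q < 1) (hp0 : 0 < p) (hp1 : p < 1) (hs0 : 0 ≤ s) (hs1 : s ≤ 1) (h : ℕ) :
    gate CH[p, s] q h = 3 * (1 - q) / (3 - q * (1 + p + p * s)) * gate δ[3] (q * (1 + p + p * s) / 3) h +
      (1 - 3 * (1 - q) / (3 - q * (1 + p + p * s))) * NP[q, p, s] h := by
  have hps : p * s ≤ p := by nlinarith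
  have hS : 0 < 1 + p + p * s := by positivity
  have hm3 : q * (1 + p + p * s) < 1 + p + p * s := by
    have := mul_lt_mul_of_pos_right hq1 hS; rwa [one_mul] at this
  have h3 : 3 - q * (1 + p + p * s) ≠ 0 := by intro e; nlinarith
  have h2 : 2 - p - p * s ≠ 0 := by intro e; nlinarith
  -- values at the atoms
  have L0 : gate CH[p, s] q 0 = 1 - q := by rw [gate_apply]; norm_num
  have L1 : gate CH[p, s] q 1 = q * (1 - p) := by rw [gate_apply]; norm_num
  have L2 : gate CH[p, s] q 2 = q * (p * (1 - s)) := by rw [gate_apply]; norm_num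
  have L3 : gate CH[p, s] q 3 = q * (p * s) := by rw [gate_apply]; norm_num
  have LM : ∀ k, 4 ≤ k → gate CH[p, s] q k = 0 := by
    intro k hk; rw [gate_apply]; simp [show k ≠ 1 by omega, show k ≠ 2 by omega, show k ≠ 3 by omega, show k ≠ 0 by omega]
  have B0 : gate δ[3] (q * (1 + p + p * s) / 3) 0 = 1 - q * (1 + p + p * s) / 3 := by rw [gate_apply]; norm_num
  have B1 : gate δ[3] (q * (1 + p + p * s) / 3) 1 = 0 := by rw [gate_apply]; norm_num
  have B2 : gate δ[3] (q * (1 + p + p * s) / 3) 2 = 0 := by rw [gate_apply]; norm_num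
  have B3 : gate δ[3] (q * (1 + p + p * s) / 3) 3 = q * (1 + p + p * s) / 3 := by rw [gate_apply]; norm_num
  have BM : ∀ k, 4 ≤ k → gate δ[3] (q * (1 + p + p * s) / 3) k = 0 := by
    intro k hk; rw [gate_apply]; simp [show k ≠ 3 by omega, show k ≠ 0 by omega]
  have N0 : NP[q, p, s] 0 = 0 := by norm_num
  have N1 : NP[q, p, s] 1 = 2 * (1 - p) / (2 - p - p * s) * (1 - (q * (1 + p + p * s) - 1) / 2) := by norm_num
  have N2 : NP[q, p, s] 2 = p * (1 - s) / (2 - p - p * s) * (1 - (q * (1 + p + p * s) - 2)) := by norm_num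
  have N3 : NP[q, p, s] 3 = 2 * (1 - p) / (2 - p - p * s) * ((q * (1 + p + p * s) - 1) / 2) +
      p * (1 - s) / (2 - p - p * s) * (q * (1 + p + p * s) - 2) := by norm_num
  have NM : ∀ k, 4 ≤ k → NP[q, p, s] k = 0 := by
    intro k hk; simp [show k ≠ 1 by omega, show k ≠ 2 by omega, show k ≠ 3 by omega]
  rcases Nat.lt_or_ge h 4 with hh | hh
  · interval_cases h
    · rw [L0, B0, N0, mul_zero, add_zero, div_mul_eq_mul_div, eq_div_iff h3]; ring
    · rw [L1, B1, N1, mul_zero, zero_add, one_sub_div h3]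
      field_simp
      ring
    · rw [L2, B2, N2, mul_zero, zero_add, one_sub_div h3]
      field_simp
      ring
    · rw [L3, B3, N3, one_sub_div h3]
      field_simp
      ring
  · rw [LM h hh, BM h hh, NM h hh]; ring

/-- law facts of a same-weight mixture of two laws (no SDEC). [this work] -/
theorem mix_laws {p m : ℝ} {M : ℕ} {μ₁ μ₂ : ℕ → ℝ} (hp0 : 0 ≤ p) (hp1 : p ≤ 1)
    (a0 : ∀ h, 0 ≤ μ₁ h) (aM : ∀ h, M < h → μ₁ h = 0) (a1 : ∑ h ∈ Finset.range (M + 1), μ₁ h = 1)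
    (am : ∑ h ∈ Finset.range (M + 1), (h : ℝ) * μ₁ h = m)
    (b0 : ∀ h, 0 ≤ μ₂ h) (bM : ∀ h, M < h → μ₂ h = 0) (b1 : ∑ h ∈ Finset.range (M + 1), μ₂ h = 1)
    (bm : ∑ h ∈ Finset.range (M + 1), (h : ℝ) * μ₂ h = m) :
    (∀ h, 0 ≤ (fun h => p * μ₁ h + (1 - p) * μ₂ h) h) ∧ (∀ h, M < h → (fun h => p * μ₁ h + (1 - p) * μ₂ h) h = 0) ∧
      ∑ h ∈ Finset.range (M + 1), (fun h => p * μ₁ h + (1 - p) * μ₂ h) h = 1 ∧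
      ∑ h ∈ Finset.range (M + 1), (h : ℝ) * (fun h => p * μ₁ h + (1 - p) * μ₂ h) h = m := by
  refine ⟨fun h => ?_, fun h hh => ?_, ?_, ?_⟩
  · exact add_nonneg (mul_nonneg hp0 (a0 h)) (mul_nonneg (by linarith) (b0 h))
  · dsimp only; rw [aM h hh, bM h hh]; ring
  · dsimp only; rw [Finset.sum_add_distrib, ← Finset.mul_sum, ← Finset.mul_sum, a1, b1]; ring
  · have e : ∀ h : ℕ, (h : ℝ) * (p * μ₁ h + (1 - p) * μ₂ h) = p * ((h : ℝ) * μ₁ h) + (1 - p) * ((h : ℝ) * μ₂ h) := fun h => by ring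
    dsimp only
    rw [Finset.sum_congr rfl fun h _ => e h, Finset.sum_add_distrib, ← Finset.mul_sum, ← Finset.mul_sum, am, bm]; ring

/-- law facts of the sub-floor part `N` of a gated 3-chain (mass `1`, mean `m = q(1+p+ps)`, vanishing above `3`). [this work] -/
theorem np_laws {q p s : ℝ} (hq0 : 0 < q) (hq1 : q < 1) (hp0 : 0 < p) (hp1 : p < 1) (hs0 : 0 < s) (hs1 : s ≤ 1)
    (hm : 2 ≤ q * (1 + p + p * s)) :
    (∀ h, 0 ≤ NP[q, p, s] h) ∧ (∀ h, 3 < h → NP[q, p, s] h = 0) ∧ ∑ h ∈ Finset.range (3 + 1), NP[q, p, s] h = 1 ∧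
      ∑ h ∈ Finset.range (3 + 1), (h : ℝ) * NP[q, p, s] h = q * (1 + p + p * s) := by
  obtain ⟨_, _, _, _, b0, b1, bd, _, _, γ0, γ1, θ0, θ1⟩ := chain3_params hq0 hq1 hp0 hp1 hs0 hs1 hm
  obtain ⟨c0, cM, c1, cmean⟩ := cp_laws (show (0 : ℝ) ≤ (q * (1 + p + p * s) - 1) / 2 by linarith) γ1.le
  obtain ⟨a0, aM, a1, amean⟩ := hp_laws θ0 θ1
  have em1 : 1 + 2 * ((q * (1 + p + p * s) - 1) / 2) = q * (1 + p + p * s) := by ring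
  have em2 : 2 + (q * (1 + p + p * s) - 2) = q * (1 + p + p * s) := by ring
  rw [em1] at cmean; rw [em2] at amean
  obtain ⟨n0, nM, n1, nmean⟩ := mix_laws b0 b1 c0 cM c1 cmean a0 aM a1 amean
  rw [bd] at n0 nM n1 nmean
  exact ⟨n0, nM, n1, nmean⟩

/-- the 3-chain sub-forest law is tree-built from relays: `{1:1−p, 2:p(1−s), 3:ps} = δ₁ ∗ gate (δ₁ ∗ gate δ₁ s) p` pointwise. [this work] -/
theorem chain3_eq_lconv (p s : ℝ) :
    lconv 1 2 δ[1] (gate (lconv 1 1 δ[1] (gate δ[1] s)) p) = CH[p, s] := by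
  funext h
  simp only [lconv, Finset.sum_range_succ, Finset.sum_range_zero, gate_apply]
  rcases Nat.lt_or_ge h 7 with hh | hh
  · interval_cases h
    all_goals norm_num
  · simp [show h ≠ 1 by omega, show h ≠ 2 by omega, show h ≠ 3 by omega, show (1 : ℕ) ≠ h by omega, show (2 : ℕ) ≠ h by omega,
      show (3 : ℕ) ≠ h by omega]

/-- **a single gated 3-chain is SDEC at every floor `0 < x ≤ qps`** (relay, gate, relay, gate, relay, gate; `s < 1`). [this work] -/
theorem sdec_chain3 {x q p s : ℝ} (hq0 : 0 < q) (hq1 : q < 1) (hp0 : 0 < p) (hp1 : p < 1) (hs0 : 0 < s) (hs1 : s < 1)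
    (hx : x ≤ q * (p * s)) : SDEC x 3 (gate CH[p, s] q) := by
  have d0 : ∀ h, 0 ≤ δ[1] h := fun h => by dsimp only; split_ifs <;> norm_num
  have dM : ∀ h, 1 < h → δ[1] h = 0 := fun h hh => by dsimp only; rw [if_neg (by omega)]
  have d1 : ∑ h ∈ Finset.range (1 + 1), δ[1] h = 1 := by simp
  -- the innermost relay, gated by `s`
  have h1 : SDEC 1 1 δ[1] := sdec_point 1 one_pos le_rfl 1
  have h1s : SDEC s 1 (gate δ[1] s) := by
    have := sdec_gate h1 s hs0 hs1.le
    rw [mul_one] at this; exact this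
  obtain ⟨b0, bM, b1⟩ := gate_laws 1 δ[1] s hs0.le hs1.le d0 dM d1
  have bmean : ∑ h ∈ Finset.range (1 + 1), (h : ℝ) * gate δ[1] s h = s := by rw [sum_mul_gate]; simp
  -- a sure relay on top: `δ₁ ∗ gate δ₁ s`, SDEC at `s`
  obtain ⟨i0, iM, i1, imean, hin⟩ := sdec_lconv_point hs0 hs1 1 b0 bM b1 (by rw [bmean]; push_cast; linarith) h1s
  rw [bmean] at imean
  rw [← lconv_comm 1 1] at i0 iM i1 imean hin
  -- the gate `p`: SDEC at `p·s`
  have hps : SDEC (p * s) (1 + 1) (gate (lconv 1 1 δ[1] (gate δ[1] s)) p) := sdec_gate hin p hp0 hp1.le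
  obtain ⟨j0, jM, j1⟩ := gate_laws (1 + 1) _ p hp0.le hp1.le i0 iM i1
  have jmean : ∑ h ∈ Finset.range (1 + 1 + 1), (h : ℝ) * gate (lconv 1 1 δ[1] (gate δ[1] s)) p h = p * (s + 1) := by
    rw [sum_mul_gate, imean]; push_cast; ring
  -- a sure relay on top again: `δ₁ ∗ gate(…) p = CH[p,s]`, SDEC at `p·s`
  have hps0 : 0 < p * s := mul_pos hp0 hs0
  have hps1 : p * s < 1 := by nlinarith
  obtain ⟨_, _, _, _, hch⟩ := sdec_lconv_point hps0 hps1 1 j0 jM j1 (by rw [jmean]; push_cast; nlinarith) hps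
  rw [← lconv_comm 1 (1 + 1), chain3_eq_lconv] at hch
  -- the root gate `q`, then lower the floor
  have hq : SDEC (q * (p * s)) 3 (gate CH[p, s] q) := sdec_gate hch q hq0 hq1.le
  exact sdec_mono hq hx (by nlinarith)

end LawDec
end Quant
end Summit.CriticalPhenomena.PercolationContinuityZ3.Theorems
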